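import Literature.NumberTheory.LFunctions.AutomaticSequenceTransducerArith7
import HarnessLib

/-!
# Arithmetic of the naturally induced transducer for the automata of Prop. 2.25 (`d = k₀ = 1`): residues are a function of the output (Müllner 2017, Thm. 2.16 / §3.2; proved)

Everything in this file is PROVED. For the automata delivered by Prop. 2.25 — `d(A) = 1` and
`k₀(A) = 1` — the residue theory of §2.4 (`AutomaticSequenceTransducerArith4–7.lean`) takes the
simple form used in §3.2/§4 of C. Müllner, *Automatic sequences fulfill the Sarnak conjecture*
(Duke Math. J. 166 (2017)) for the special representations `D_ℓ(g) = e(ℓ s₀(g)/d')`: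

* `s0Slope_eq_zero_of_transducerK0_eq_one` — `k₀ = 1` iff the common slope `a` vanishes;
* `MinImage.natCast_wordVal_loop_of_k0` — `k₀ = 1`: for every digit loop `w` at `M` of length
  `ℓ d`, `ℓ ≥ ℓ*`: `[w]_k ≡ s₀(T(M, w)) (mod d')` — the number of a loop modulo `d'` is the value
  of the homomorphism `s₀ : G_M → ZMod d'` at its output (Müllner's `D_ℓ(T(q, w)) = e(ℓ [w]_k / d')`);
* `MinImage.natCast_wordVal_path_of_k0` — the same for paths between arbitrary states, with the
  two normalisation constants of the fixed connecting paths;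
* `MinImage.exists_loop_of_period_eq_one` — `d = 1`: every `g ∈ G_M` is the output of digit loops
  at `M` of EVERY length `n ≥ m` (Thm. 2.7 (2) with `d = 1`);
* `MinImage.exists_path_of_period_eq_one` — `d = 1`: between any two states there are digit paths
  of every length `n ≥ m` realising every element of the single class `G_{M M'}` (Lemma 2.10).

## References
* C. Müllner, Duke Math. J. 166 (2017): Thm. 2.7, Thm. 2.16, Prop. 2.25, Lemma 3.5 (`D_ℓ`).
  [Mullner2017]
-/

noncomputable section

open Finset

namespace Literature.NumberTheory.LFunctions

variable {σ : Type*} [Fintype σ] [DecidableEq σ] {k : ℕ}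

/-- `k₀(A) = 1 ↔ a = 0` for the common slope `a = s0Slope`. [cite: Mullner2017, Lemma 2.21] -/
theorem s0Slope_eq_zero_of_transducerK0_eq_one (hk : 2 ≤ k) (δ : σ → ℕ → σ)
    (htriv : ∀ q d, k ≤ d → δ q d = q) (h : transducerK0 hk δ htriv = 1) :
    MinImage.s0Slope hk htriv (δ := δ) = 0 := by
  have := transducerK0_nsmul_s0Slope' hk δ htriv
  rwa [h, one_nsmul] at this
where
  /-- `k₀ • a = 0` (restated locally to keep this file independent of the power files). -/
  transducerK0_nsmul_s0Slope' (hk : 2 ≤ k) (δ : σ → ℕ → σ) (htriv : ∀ q d, k ≤ d → δ q d = q) :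
      transducerK0 hk δ htriv • MinImage.s0Slope hk htriv (δ := δ) = 0 := by
    have h := (MinImage.exists_common_slope hk htriv (δ := δ)).choose_spec.choose_spec
    have huniq : (MinImage.exists_common_slope hk htriv (δ := δ)).choose_spec.choose =
        MinImage.s0Slope hk htriv (δ := δ) :=
      MinImage.sVal_one_slope_eq hk htriv (fun ℓ hℓ => h (transducerBase δ) ℓ hℓ)
        ((MinImage.s0_spec hk htriv (δ := δ)).2.2 (transducerBase δ))
    rw [← huniq, transducerK0]
    exact addOrderOf_nsmul_eq_zero _

namespace MinImage

variable {δ : σ → ℕ → σ}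

/-- **`k₀ = 1`: the number of a loop modulo `d'` is `s₀` of its output** — for every digit loop
`w` at `M` of length `ℓ d` with `ℓ ≥ ℓ*`, `[w]_k ≡ s₀(T(M,w)) (mod d')`.
[cite: Mullner2017, Thm. 2.16 / Lemma 3.5] -/
theorem natCast_wordVal_loop_of_k0 (hk : 2 ≤ k) (htriv : ∀ q d, k ≤ d → δ q d = q)
    (hk0 : transducerK0 hk δ htriv = 1) (M : MinImage δ) {w : List ℕ} (hwd : ∀ d ∈ w, d < k)
    {ℓ : ℕ} (hwl : w.length = ℓ * transducerPeriod k δ) (hwn : M.next w = M)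
    (hℓ : s0Level hk htriv (δ := δ) ≤ ℓ) :
    ((wordVal k w : ℕ) : ZMod (transducerDPrime hk δ htriv)) = M.s0 hk htriv (M.T w) := by
  rw [M.natCast_wordVal_loop hk htriv hwd hwl hwn hℓ,
    s0Slope_eq_zero_of_transducerK0_eq_one hk δ htriv hk0, nsmul_zero, add_zero]

/-- **`k₀ = 1`: residues of paths between arbitrary states** — with fixed connecting digit paths
`p : M₀ → M` (length `P d`, `P ≥ ℓ*`) and `q : M' → M₀` (length `Q d`), every digit path
`w : M → M'` of length `ℓ d` has `[w]_k ≡ s₀(T(p) ≫ T(M,w) ≫ T(q)) − [p]_k − [q]_k (mod d')`.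
[cite: Mullner2017, Prop. 2.23 / Thm. 2.16] -/
theorem natCast_wordVal_path_of_k0 (hk : 2 ≤ k) (htriv : ∀ q d, k ≤ d → δ q d = q)
    (hk0 : transducerK0 hk δ htriv = 1) {M₀ M M' : MinImage δ}
    {p : List ℕ} (hpd : ∀ d ∈ p, d < k) {P : ℕ} (hpl : p.length = P * transducerPeriod k δ)
    (hpn : M₀.next p = M) (hP : s0Level hk htriv (δ := δ) ≤ P)
    {q : List ℕ} (hqd : ∀ d ∈ q, d < k) {Q : ℕ} (hql : q.length = Q * transducerPeriod k δ)
    (hqn : M'.next q = M₀)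
    {w : List ℕ} (hwd : ∀ d ∈ w, d < k) {ℓ : ℕ} (hwl : w.length = ℓ * transducerPeriod k δ)
    (hwn : M.next w = M') :
    ((wordVal k w : ℕ) : ZMod (transducerDPrime hk δ htriv)) =
      M₀.s0 hk htriv ((M₀.T p).trans ((M.T w).trans (M'.T q))) - wordVal k p - wordVal k q := by
  rw [natCast_wordVal_path hk htriv hpd hpl hpn hP hqd hql hqn hwd hwl hwn,
    s0Slope_eq_zero_of_transducerK0_eq_one hk δ htriv hk0, nsmul_zero, add_zero]

/-- **`d = 1`: every `g ∈ G_M` is realised by digit loops at `M` of every large length**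
(Thm. 2.7 (2) with `d = 1`). [cite: Mullner2017, Thm. 2.7] -/
theorem exists_loop_of_period_eq_one (hk : 0 < k) (htriv : ∀ q d, k ≤ d → δ q d = q)
    (hd : transducerPeriod k δ = 1) (M : MinImage δ) :
    ∃ m : ℕ, ∀ n : ℕ, m ≤ n → ∀ g ∈ M.loopGroup hk htriv,
      ∃ w : List ℕ, (∀ d ∈ w, d < k) ∧ w.length = n ∧ M.next w = M ∧ M.T w = g := by
  obtain ⟨m, hm⟩ := M.exists_forall_exists_loop_eq hk htriv
  refine ⟨m, fun n hn g hg => ?_⟩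
  obtain ⟨w, hwd, hwl, hwn, hwT⟩ := hm n hn g hg
  exact ⟨w, hwd, by rw [hwl, hd, mul_one], hwn, hwT⟩

/-- **`d = 1`: paths of every large length realise every element of the class** — for all
states `M, M'`, every class `c` (they all coincide when `d = 1`), all `n ≥ m` and every
`g ∈ G_{M M'}(c)` there is a digit path of length exactly `n` from `M` to `M'` with output `g`
(Lemma 2.10 with `d = 1`). [cite: Mullner2017, Lemma 2.10] -/
theorem exists_path_of_period_eq_one (hk : 0 < k) (htriv : ∀ q d, k ≤ d → δ q d = q)
    (hd : transducerPeriod k δ = 1) :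
    ∃ m : ℕ, ∀ (M M' : MinImage δ) (c : ZMod (transducerPeriod k δ)) (n : ℕ), m ≤ n →
      ∀ g ∈ M.pathOutputs k M' c,
        ∃ w : List ℕ, (∀ d ∈ w, d < k) ∧ w.length = n ∧ M.next w = M' ∧ M.T w = g := by
  haveI : NeZero (transducerPeriod k δ) := ⟨(transducerPeriod_pos hk htriv).ne'⟩
  obtain ⟨m, hm⟩ := exists_forall_realize hk htriv (δ := δ)
  refine ⟨m, fun M M' c n hn g hg => ?_⟩
  have hval : c.val = 0 := by
    have hlt := ZMod.val_lt c
    omega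
  obtain ⟨w, hwd, hwl, hwn, hwT⟩ := hm M M' c g hg n hn
  exact ⟨w, hwd, by rw [hwl, hval, zero_add, hd, mul_one], hwn, hwT⟩

end MinImage

end Literature.NumberTheory.LFunctions
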